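import Summits.ResolutionOfSingularities.ResolutionOfSingularities.Theorems.ResidueCutLaws
import HarnessLib

/-!
# ResidueCutCells — decomp-res node «ResidueCut» (lens-2 g25, critic row 200 CLEARED MAP +1), tree file 2/4 of the node

Content VERBATIM from the decomp-res lens-2 g25 node `HOME/decomp-res-lens-2/g25/ResidueCut.lean` (pin 4d29427b; no
carry, imports the landed tree only; ns `…Theses.ResidueCut` ↦ `…Theorems.ResidueCut`); HOME =
run/shared/lean/pub/decomp-res; critic CRITIC-LEDGER row 200 CLEARED MAP +1; landing orders INBOX 08:49:37Z /
08:52:28Z / 09:07:12Z — provenance, critic text and the lens header in full in the first file of the node,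
`ResidueCutLaws`.  `--kind proof --supports stmt-ResolutionOfSingularities-29273`.

## This file

§3 CUT A — the dichotomy ON THE DATA: `SeqDimFourPerfCoprime` / `SeqDimFourWild`, `seqDimFour_iff_slices`,
`seqDimFourPerfCoprime_iff`, the slices `RungOnePerfCoprime` (DECIDED in kernel from `E 2`:
`rungOnePerfCoprime_holds`) / **`RungOneWild`** (`p ∣ n ∨ k` imperfect — THE RESIDUAL, WEAKER by letter, UNDECIDED);
§4 CUT B — `namespace Res`: the schema for EVERY leaf `L` (`IsResSpecialPt`, `ResSpecialRung`, `ResWildSpecialRung`,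
`specialRung_iff_resWildSpecialRung` / `specialRung_iff_resSpecialRung`, EXACT & hyp-free); §5 READING across
columns (closed points of the residual at `p ∤ n` are lens-6's); §6b the ALIAS under the critic's literal name row
197a (5) (`ResX.oddSpecialRung_iff_resSpecialRung`; the (1)-alias = the landed `isContactPt_of_sepResidue`, deleted
here) and the cn30 RESIDUAL-MEMBERSHIP LAW `dvd_or_not_sepResidueAt_of_not_classGE_two`.  The wiring on the host
route (`rungOne_iff_wild`, `closesA`, `namespace ResX`) lives in `MaxContactCutResidueCut`.

[WRITER NOTE (decomp-res writer g13): file split only (tree files ≤ 400 lines); sections, namespaces, section `open`s and every declaration exactly as in the lens (the node's HOME-only dupNamespace-linter line is dropped; the namespace-level `open` lines of the node are replayed in every part, the `open …Theses` line only in the Theses-cone file `MaxContactCutResidueCut`); namespace renamed `…Theses.ResidueCut` ↦ `…Theorems.ResidueCut`; ONE dedup deletion in THIS file: the lens's §6b ALIAS `isContactPt_of_sepResidueAt_of_not_dvd` (the critic's literal name, row 197a (1); a one-line `:=` of §1's law) is STATEMENT-IDENTICAL to the landed `isContactPt_of_sepResidue` (`ResidueCutLaws`, p818049; proposal p818219 bounced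 `dedup.landed`) — the alias is DELETED; for «closed `y`, separable residue field over `k`, `idealOrder I y = n`, `p ∤ n` ⇒ `IsContactPt g I n y`» cite `ResidueCut.isContactPt_of_sepResidue` (the §7 docstring that names the alias means that theorem).]

(Sources: EGAIV4 Thm. 16.11.2; StacksProject 00TV; CossartPiltant2008 Prop. 4.2; VillamayorU2008ReesDiff §4.1;
BierstoneGrigorievMilmanWlodarczyk2011 §3.1; Cutkosky2009; Hironaka1964 Ch. III; Kollar2007 Lemma 3.74; Hauser2003 §4.)
-/

open CategoryTheory AlgebraicGeometry TopologicalSpace IsLocalRing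
open Literature.AlgebraicGeometry.Resolution
open Summit.ResolutionOfSingularities.ResolutionOfSingularities.Theorems
open Summit.ResolutionOfSingularities.ResolutionOfSingularities.Theorems.WeakOrderReduction
open Summit.ResolutionOfSingularities.ResolutionOfSingularities.Theorems.ForcedTowerClasses
open Summit.ResolutionOfSingularities.ResolutionOfSingularities.Theorems.CurveLeafExit
open Summit.ResolutionOfSingularities.ResolutionOfSingularities.Theorems.PurityCut
open Summit.ResolutionOfSingularities.ResolutionOfSingularities.Theorems.AbsoluteContactClasses
open Summit.ResolutionOfSingularities.ResolutionOfSingularities.Theorems.DeltaFaceCutClasses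
open Summit.ResolutionOfSingularities.ResolutionOfSingularities.Theorems.RelativeDeltaCut
open Summit.ResolutionOfSingularities.ResolutionOfSingularities.Theorems.DeepCrossCut
open Summit.ResolutionOfSingularities.ResolutionOfSingularities.Theorems.PinchCut
open Summit.ResolutionOfSingularities.ResolutionOfSingularities.Theorems.JetCut
open Summit.ResolutionOfSingularities.ResolutionOfSingularities.Theorems.SplitCut
open Summit.ResolutionOfSingularities.ResolutionOfSingularities.Theorems.CylinderCut
open Summit.ResolutionOfSingularities.ResolutionOfSingularities.Theorems.SpreadCut
open Summit.ResolutionOfSingularities.ResolutionOfSingularities.Theorems.CrossCut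
open Summit.ResolutionOfSingularities.ResolutionOfSingularities.Theorems.OddCrossCut

namespace Summit.ResolutionOfSingularities.ResolutionOfSingularities.Theorems.ResidueCut

/-! ## §3  CUT A — the dichotomy on the data: perfect-coprime slice DECIDED, wild-or-imperfect slice = residual -/

/-- **`SeqDimFourPerfCoprime j n`** — the PERFECT-COPRIME SLICE of `SeqDimFour j n`: `k` perfect and `p ∤ n`.
STATEMENT SCHEMA (decided piece for j ≥ 2 ⇒ j = 1, below). (Sources: BierstoneGrigorievMilmanWlodarczyk2011 §3.1.) -/
def SeqDimFourPerfCoprime (j n : ℕ) : Prop :=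
  ∀ p : ℕ, p.Prime → ¬ p ∣ n → ∀ (k : Type) [Field k] [CharP k p] [PerfectField k]
    (Y : Scheme.{0}) (g : Y ⟶ Spec (.of k)), IsSeparated g → LocallyOfFiniteType g → QuasiCompact g →
    ∀ hY : Scheme.IsRegular Y, topologicalKrullDim Y ≤ 4 →
    ∀ I : Y.IdealSheafData, (∀ y : Y, idealOrder I y ≤ ((n : ℕ) : ℕ∞)) →
      (∀ y : Y, idealOrder I y = ((n : ℕ) : ℕ∞) → ClassGE g hY I n j y) →
      ∃ t : CentreSeq Y, WeakResolution t (⟨I, [], n⟩ : MarkedIdeal Y)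

/-- **`SeqDimFourWild j n`** — the WILD-OR-IMPERFECT SLICE of `SeqDimFour j n`: `p ∣ n` or `k` imperfect.
STATEMENT SCHEMA (the residual side of CUT A). (Sources: Hironaka1964 Ch. III; Moh1987; CossartPiltant2019 Rem. 3.2.) -/
def SeqDimFourWild (j n : ℕ) : Prop :=
  ∀ p : ℕ, p.Prime → ∀ (k : Type) [Field k] [CharP k p], (p ∣ n ∨ ¬ PerfectField k) →
    ∀ (Y : Scheme.{0}) (g : Y ⟶ Spec (.of k)), IsSeparated g → LocallyOfFiniteType g → QuasiCompact g →
    ∀ hY : Scheme.IsRegular Y, topologicalKrullDim Y ≤ 4 →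
    ∀ I : Y.IdealSheafData, (∀ y : Y, idealOrder I y ≤ ((n : ℕ) : ℕ∞)) →
      (∀ y : Y, idealOrder I y = ((n : ℕ) : ℕ∞) → ClassGE g hY I n j y) →
      ∃ t : CentreSeq Y, WeakResolution t (⟨I, [], n⟩ : MarkedIdeal Y)

/-- EXHAUSTION of CUT A at one marking (pure logic, `em`). [folklore] -/
theorem seqDimFour_iff_slices {j n : ℕ} : SeqDimFour j n ↔ SeqDimFourPerfCoprime j n ∧ SeqDimFourWild j n := by
  constructor
  · intro h
    exact ⟨fun p hp _ k _ _ _ Y g hs hl hq hY hd I hle hcl => h p hp k Y g hs hl hq hY hd I hle hcl,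
      fun p hp k _ _ _ Y g hs hl hq hY hd I hle hcl => h p hp k Y g hs hl hq hY hd I hle hcl⟩
  · rintro ⟨hP, hW⟩ p hp k _ _ Y g hs hl hq hY hd I hle hcl
    by_cases hw : p ∣ n ∨ ¬ PerfectField k
    · exact hW p hp k hw Y g hs hl hq hY hd I hle hcl
    · push Not at hw
      haveI : PerfectField k := hw.2
      exact hP p hp hw.1 k Y g hs hl hq hY hd I hle hcl

/-- **THE COLLAPSE on the perfect-coprime slice**: the slice of `SeqDimFour j n` is ONE statement for all `j` (every
top point is of every class, `classGE_of_perfectField`) — column 29273 (`j = 1, 2`) coincides there with lens-5's contact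
column (`j = 5`). KERNEL (PROVED). (Sources: EGAIV4 Thm. 16.11.2; BierstoneGrigorievMilmanWlodarczyk2011 §3.1.) -/
theorem seqDimFourPerfCoprime_iff {n : ℕ} (hn : 1 ≤ n) (j j' : ℕ) :
    SeqDimFourPerfCoprime j n ↔ SeqDimFourPerfCoprime j' n := by
  constructor <;> intro h p hp hpn k _ _ _ Y g hs hl hq hY hd I hle _ <;>
    exact h p hp hpn k Y g hs hl hq hY hd I hle
      (fun y hy => classGE_of_perfectField hp g ⟨hs, hl, hq, hY, hd⟩ I hn hpn hle _ hy)

/-- `RungOnePerfCoprime` — `RungOne` on the perfect-coprime slice. STATEMENT (decided piece). -/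
def RungOnePerfCoprime : Prop := E 2 → ∀ n : ℕ, 1 ≤ n → SeqDimFourPerfCoprime 1 n

/-- **`RungOneWild`** — `RungOne` on the wild-or-imperfect slice: THE RESIDUAL of CUT A (WEAKER by letter).
STATEMENT (located residual). -/
def RungOneWild : Prop := E 2 → ∀ n : ℕ, 1 ≤ n → SeqDimFourWild 1 n

/-- **DECIDED (kernel, hypothesis-free): `RungOne` holds on the perfect-coprime slice.** [folklore] -/
theorem rungOnePerfCoprime_holds : RungOnePerfCoprime := fun hE2 n hn =>
  (seqDimFourPerfCoprime_iff hn 1 2).mpr (seqDimFour_iff_slices.mp (hE2 n hn)).1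

namespace Res

variable (L : ∀ ⦃Y : Scheme.{0}⦄, Y.IdealSheafData → ℕ → Y → Prop)

/-! ## §4  CUT B — the separable kind removed from the located class of EVERY leaf (schema level, exact, hyp-free) -/

/-- **RES-SPECIAL point for the leaf `L`**: `L`-special and NOT of the separable kind. DEFINITION (NEW located class).
[folklore] -/
def IsResSpecialPt {k : Type} [Field k] {Y : Scheme.{0}} (g : Y ⟶ Spec (.of k)) (hY : Scheme.IsRegular Y)
    (I : Y.IdealSheafData) (n : ℕ) (y : Y) : Prop :=
  Leaf.IsSpecPt L g hY I n y ∧ ¬ IsSepKindPt g I n y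

/-- **`SeqResSpec L n`** — weak order reduction at marking `n` for data having a RES-SPECIAL top point (frame = the
binders of `SeqDimFour`). STATEMENT SCHEMA (located residual of CUT B). (Sources: BierstoneGrigorievMilmanWlodarczyk2011
§3.1; CossartPiltant2019 Rem. 3.2; Moh1987.) -/
def SeqResSpec (n : ℕ) : Prop :=
  ∀ p : ℕ, p.Prime → ∀ (k : Type) [Field k] [CharP k p]
    (Y : Scheme.{0}) (g : Y ⟶ Spec (.of k)), IsSeparated g → LocallyOfFiniteType g → QuasiCompact g →
    ∀ hY : Scheme.IsRegular Y, topologicalKrullDim Y ≤ 4 →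
    ∀ I : Y.IdealSheafData, (∀ y : Y, idealOrder I y ≤ ((n : ℕ) : ℕ∞)) →
      (∃ y : Y, idealOrder I y = ((n : ℕ) : ℕ∞) ∧ IsResSpecialPt L g hY I n y) →
      ∃ t : CentreSeq Y, WeakResolution t (⟨I, [], n⟩ : MarkedIdeal Y)

/-- **`SeqResWildSpec L n`** — the same on the WILD-OR-IMPERFECT slice (`p ∣ n ∨ k` imperfect): CUT A ∘ CUT B.
STATEMENT SCHEMA (the located residual after g25). -/
def SeqResWildSpec (n : ℕ) : Prop :=
  ∀ p : ℕ, p.Prime → ∀ (k : Type) [Field k] [CharP k p], (p ∣ n ∨ ¬ PerfectField k) →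
    ∀ (Y : Scheme.{0}) (g : Y ⟶ Spec (.of k)), IsSeparated g → LocallyOfFiniteType g → QuasiCompact g →
    ∀ hY : Scheme.IsRegular Y, topologicalKrullDim Y ≤ 4 →
    ∀ I : Y.IdealSheafData, (∀ y : Y, idealOrder I y ≤ ((n : ℕ) : ℕ∞)) →
      (∃ y : Y, idealOrder I y = ((n : ℕ) : ℕ∞) ∧ IsResSpecialPt L g hY I n y) →
      ∃ t : CentreSeq Y, WeakResolution t (⟨I, [], n⟩ : MarkedIdeal Y)

/-- `ResSpecialRung L` — the located residual of CUT B. STATEMENT SCHEMA. -/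
def ResSpecialRung : Prop := E 2 → ∀ n : ℕ, 1 ≤ n → SeqResSpec L n

/-- **`ResWildSpecialRung L`** — THE LOCATED RESIDUAL AFTER g25 for the leaf `L` (CUT A ∘ CUT B). STATEMENT SCHEMA. -/
def ResWildSpecialRung : Prop := E 2 → ∀ n : ℕ, 1 ≤ n → SeqResWildSpec L n

variable {L}

/-- **EXACT CUT B at a marking (hypothesis-free): `SeqSpec L n ⟺ SeqResSpec L n`** — an `L`-special top point is never
of the separable kind. KERNEL (PROVED). [folklore] -/
theorem seqSpec_iff_seqResSpec {n : ℕ} (hn : 1 ≤ n) : Leaf.SeqSpec L n ↔ SeqResSpec L n := by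
  constructor
  · intro h p hp k _ _ Y g hs hl hq hY hd I hle hex
    obtain ⟨y, hy, hys⟩ := hex
    exact h p hp k Y g hs hl hq hY hd I hle ⟨y, hy, hys.1⟩
  · intro h p hp k _ _ Y g hs hl hq hY hd I hle hex
    obtain ⟨y, hy, hys⟩ := hex
    exact h p hp k Y g hs hl hq hY hd I hle
      ⟨y, hy, hys, fun hk => not_isSpecPt_of_isSepKindPt L hp g ⟨hs, hl, hq, hY, hd⟩ I hn hy hk hys⟩

/-- **EXACT at a marking (hypothesis-free): `SeqSpec L n ⟺ SeqResWildSpec L n`** — on the perfect-coprime slice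
there is NO `L`-special top point at all (`not_isLeafSpecialPt_of_perfectField`). KERNEL (PROVED). [folklore] -/
theorem seqSpec_iff_seqResWildSpec {n : ℕ} (hn : 1 ≤ n) : Leaf.SeqSpec L n ↔ SeqResWildSpec L n := by
  constructor
  · intro h p hp k _ _ _ Y g hs hl hq hY hd I hle hex
    obtain ⟨y, hy, hys⟩ := hex
    exact h p hp k Y g hs hl hq hY hd I hle ⟨y, hy, hys.1⟩
  · intro h p hp k _ _ Y g hs hl hq hY hd I hle hex
    obtain ⟨y, hy, hys⟩ := hex
    by_cases hw : p ∣ n ∨ ¬ PerfectField k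
    · exact h p hp k hw Y g hs hl hq hY hd I hle
        ⟨y, hy, hys, fun hk => not_isSpecPt_of_isSepKindPt L hp g ⟨hs, hl, hq, hY, hd⟩ I hn hy hk hys⟩
    · push Not at hw
      haveI : PerfectField k := hw.2
      exact absurd hys.1 (not_isLeafSpecialPt_of_perfectField hp g ⟨hs, hl, hq, hY, hd⟩ I hn hw.1 hle hy)

/-- **EXACT CUT B at the rung (hypothesis-free): `SpecialRung L ⟺ ResSpecialRung L`.** [folklore] -/
theorem specialRung_iff_resSpecialRung : Leaf.SpecialRung L ↔ ResSpecialRung L :=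
  ⟨fun h hE2 n hn => (seqSpec_iff_seqResSpec hn).mp (h hE2 n hn),
    fun h hE2 n hn => (seqSpec_iff_seqResSpec hn).mpr (h hE2 n hn)⟩

/-- **EXACT at the rung (hypothesis-free): `SpecialRung L ⟺ ResWildSpecialRung L`** (CUT A ∘ CUT B). [folklore] -/
theorem specialRung_iff_resWildSpecialRung : Leaf.SpecialRung L ↔ ResWildSpecialRung L :=
  ⟨fun h hE2 n hn => (seqSpec_iff_seqResWildSpec hn).mp (h hE2 n hn),
    fun h hE2 n hn => (seqSpec_iff_seqResWildSpec hn).mpr (h hE2 n hn)⟩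

/-- Monotonicity in the leaf survives the cut (bigger leaf ⇒ smaller residual). [folklore] -/
theorem resWildSpecialRung_mono {L L' : ∀ ⦃Y : Scheme.{0}⦄, Y.IdealSheafData → ℕ → Y → Prop}
    (hLL' : ∀ ⦃Y : Scheme.{0}⦄ (I : Y.IdealSheafData) (n : ℕ) (y : Y), L I n y → L' I n y)
    (h : ResWildSpecialRung L) : ResWildSpecialRung L' :=
  specialRung_iff_resWildSpecialRung.mp
    (Leaf.specialRung_mono hLL' (specialRung_iff_resWildSpecialRung.mpr h))

end Res

/-! ## §5  READING across columns (no claim): the CLOSED points of the residual at `p ∤ n` are lens-6's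
ABSOLUTE-contact, `k`-contact-free, inseparable-residue points over an IMPERFECT field -/

/-- **The imperfect side of the residual, read at a closed point** (`p ∤ n`): a closed leaf-special top point has
ABSOLUTE (`ℤ`-linear) maximal contact (lens-6's tree theorem `isAbsContactAt_of_not_dvd`), NO `k`-linear contact,
an INSEPARABLE residue field over `k`, and `k` is IMPERFECT.  KERNEL (PROVED; a reading, not a decision).
(Sources: EGAIV4 Thm. 16.11.2; CossartPiltant2008 Prop. 4.2.) -/
theorem closed_residual_reading {p : ℕ} (hp : p.Prime) {k : Type} [Field k] [CharP k p] {Y : Scheme.{0}}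
    (g : Y ⟶ Spec (.of k)) (hB : IsBase Y g) (I : Y.IdealSheafData) {n : ℕ} (hn : 1 ≤ n) (hpn : ¬ p ∣ n)
    {y : Y} (hy : IsClosed ({y} : Set Y)) (hord : idealOrder I y = ((n : ℕ) : ℕ∞))
    (hs : IsLeafSpecialPt g hB.isRegular I n y) :
    IsAbsContactAt I n y ∧ ¬ IsContactPt g I n y ∧ ¬ SepResidueAt g y ∧ ¬ PerfectField k :=
  have h := not_sepResidueAt_of_isLeafSpecialPt hp g hB I hn hpn hy hord hs
  ⟨isAbsContactAt_of_not_dvd hp hn hpn Y g hB I y hy hord,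
    fun hc => not_gen_of_isLeafSpecialPt hs (Or.inl (Or.inr (Or.inl hc))), h.1, h.2⟩

/-- The same for the RES-SPECIAL class of any leaf `L` (CUT B's located class). KERNEL (PROVED). [folklore] -/
theorem closed_resSpecial_reading (L : ∀ ⦃Y : Scheme.{0}⦄, Y.IdealSheafData → ℕ → Y → Prop) {p : ℕ}
    (hp : p.Prime) {k : Type} [Field k] [CharP k p] {Y : Scheme.{0}} (g : Y ⟶ Spec (.of k)) (hB : IsBase Y g)
    (I : Y.IdealSheafData) {n : ℕ} (hn : 1 ≤ n) (hpn : ¬ p ∣ n) {y : Y} (hy : IsClosed ({y} : Set Y))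
    (hord : idealOrder I y = ((n : ℕ) : ℕ∞)) (hs : Res.IsResSpecialPt L g hB.isRegular I n y) :
    IsAbsContactAt I n y ∧ ¬ IsContactPt g I n y ∧ ¬ SepResidueAt g y ∧ ¬ PerfectField k :=
  closed_residual_reading hp g hB I hn hpn hy hord hs.1.1

namespace ResX

open Res

/-! ## §6  BY NAME on the tree: the odd level (g23, landed) and `closes` to `MaxContactCut.RungOne` -/

/-- The located residual after g25 on the LANDED column: odd-special (tree `IsOddSpecialPt`, g23) ∧ not of the
separable kind, on wild-or-imperfect data. STATEMENT (located residual). -/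
def OddResSpecialRung : Prop := ResWildSpecialRung oddLeaf

/-- **EXACT (hypothesis-free): `OddX.OddSpecialRung ⟺ OddResSpecialRung`.** [folklore] -/
theorem oddSpecialRung_iff_res : OddX.OddSpecialRung ↔ OddResSpecialRung :=
  OddX.oddSpecialRung_iff.trans specialRung_iff_resWildSpecialRung

end ResX

/-- **(197a (5), point level, hypothesis-free) `OddX.OddSpecialRung ⟺ Res.ResSpecialRung oddLeaf`** on the LANDED odd
names (the wild-data version is `ResX.oddSpecialRung_iff_res`). KERNEL (PROVED). [folklore] -/
theorem ResX.oddSpecialRung_iff_resSpecialRung : OddX.OddSpecialRung ↔ Res.ResSpecialRung oddLeaf :=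
  OddX.oddSpecialRung_iff.trans Res.specialRung_iff_resSpecialRung

/-- **cn30 RESIDUAL-MEMBERSHIP LAW (critic row 197a (iii)), kernel form** — at a CLOSED top point that is NOT of
class ≥ 2 (in particular at every leaf-special / odd-special / cusp-special point): `p ∣ n ∨` the residue field is
INSEPARABLE over `k`.  An inhabitant certifies a cell of this column only together with this clause; INSEP-v³
(`p = 2 = n`) satisfies the first disjunct (`dvd_rfl`), the inseparable-kind inhabitant of §7 the second.
KERNEL (PROVED). (Sources: EGAIV4 Thm. 16.11.2; CossartPiltant2008 Prop. 4.2.) -/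
theorem dvd_or_not_sepResidueAt_of_not_classGE_two {p : ℕ} (hp : p.Prime) {k : Type} [Field k] [CharP k p]
    {Y : Scheme.{0}} (g : Y ⟶ Spec (.of k)) (hB : IsBase Y g) (I : Y.IdealSheafData) {n : ℕ} (hn : 1 ≤ n)
    {y : Y} (hy : IsClosed ({y} : Set Y)) (hord : idealOrder I y = ((n : ℕ) : ℕ∞))
    (h : ¬ ClassGE g hB.isRegular I n 2 y) : p ∣ n ∨ ¬ SepResidueAt g y := by
  by_cases hpn : p ∣ n
  · exact Or.inl hpn
  · exact Or.inr fun hsep =>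
      h (classGE_of_isSepKindPt hp g hB I hn 2 hord ⟨by rwa [ringChar.eq k p], y, specializes_rfl, hy, hsep, hord⟩)

/-- The same at a general (possibly non-closed) top point: `p ∣ n ∨` NO closed specialisation of the same order has
separable residue field. KERNEL (PROVED). [folklore] -/
theorem dvd_or_forall_not_sepResidueAt_of_not_classGE_two {p : ℕ} (hp : p.Prime) {k : Type} [Field k] [CharP k p]
    {Y : Scheme.{0}} (g : Y ⟶ Spec (.of k)) (hB : IsBase Y g) (I : Y.IdealSheafData) {n : ℕ} (hn : 1 ≤ n)
    {y : Y} (hord : idealOrder I y = ((n : ℕ) : ℕ∞)) (h : ¬ ClassGE g hB.isRegular I n 2 y) :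
    p ∣ n ∨ ∀ x : Y, y ⤳ x → IsClosed ({x} : Set Y) → idealOrder I x = ((n : ℕ) : ℕ∞) → ¬ SepResidueAt g x := by
  by_cases hpn : p ∣ n
  · exact Or.inl hpn
  · exact Or.inr fun x hyx hxc hordx hsep =>
      h (classGE_of_isSepKindPt hp g hB I hn 2 hord ⟨by rwa [ringChar.eq k p], x, hyx, hxc, hsep, hordx⟩)

/-- The law at a LEAF-SPECIAL point (every leaf of the lineage: `IsSpecPt L … ⇒ IsLeafSpecialPt`). KERNEL (PROVED).
[folklore] -/
theorem dvd_or_not_sepResidueAt_of_isLeafSpecialPt {p : ℕ} (hp : p.Prime) {k : Type} [Field k] [CharP k p]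
    {Y : Scheme.{0}} (g : Y ⟶ Spec (.of k)) (hB : IsBase Y g) (I : Y.IdealSheafData) {n : ℕ} (hn : 1 ≤ n)
    {y : Y} (hy : IsClosed ({y} : Set Y)) (hord : idealOrder I y = ((n : ℕ) : ℕ∞))
    (hs : IsLeafSpecialPt g hB.isRegular I n y) : p ∣ n ∨ ¬ SepResidueAt g y :=
  dvd_or_not_sepResidueAt_of_not_classGE_two hp g hB I hn hy hord fun hc => not_gen_of_isLeafSpecialPt hs (Or.inl hc)

end Summit.ResolutionOfSingularities.ResolutionOfSingularities.Theorems.ResidueCut
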